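import Summits.KontsevichZagierPeriods.KontsevichZagierPeriods.Theses.LiouvilleUnfolding
import Summits.KontsevichZagierPeriods.KontsevichZagierPeriods.Theorems.LiouvilleUnfoldingLogKernelConjectureIffSummit
import Summits.KontsevichZagierPeriods.KontsevichZagierPeriods.Theorems.LiouvilleUnfoldingLogKernelConjectureCensusRing
import Literature.NumberTheory.Transcendental.KZKernelConjectureForms

/-!
# Strategist sketch for crux `LiouvilleUnfolding.LogKernelConjecture` (stmt-KontsevichZagierPeriods-2837)

Typed material behind `STRATEGY-CENSUS.md` (planner-cstrat-stmt-KontsevichZagierPeriods-2837-0,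
2026-08-16). Nothing here is a registered line: every composition below concludes the crux only from
a stub set that is jointly EQUIVALENT to `KontsevichZagierPeriods` (tree theorem
`SpectatorLocalisation.logKernelConjecture_iff_summit`, p95927), which is the point of the census.

* §D-a  the landed exact split `DarkTorsionOne ∧ SpectatorFibrationOne` (= registered stubs DT₁, SF₁),
        with the glue `LogKernelConjecture_of_subs` proved from tree theorems and its converse;
* §D-b  the dimension split `KernelDimLeOne ∧ KernelReducesToDimOne` with glue and the converse of the
        second piece (so the second piece is the whole crux modulo the first, which is theorem-grade);
* §S    two typed strengthenings: bounded excursion height `BoundedHeightKZ h` (⇒ summit, proved) and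
        the functional dilation statement `FunctionalDilationKZ` (⇐ summit, proved) that the
        uniform-in-families strengthening S⁺_unif reduces to off the isolated coincidences;
* §N    the kill shape is quoted from `Cruxes/LogKernelConjecture/Disproof.lean` §15 (not re-proved).
-/

noncomputable section

set_option linter.dupNamespace false

open Literature.NumberTheory.Transcendental
open scoped BigOperators

namespace Summit.KontsevichZagierPeriods.KontsevichZagierPeriods.Cruxes.LogKernelConjecture.Strategist

open Summit.KontsevichZagierPeriods.KontsevichZagierPeriods.Theses.LiouvilleUnfolding
  (LogKernelConjecture LogPrimitiveNL)

/-! ## §D-a The localisation split (landed: p87631 + p95927) -/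

/-- DT₁ (dark torsion, one-dimensional spectators): the registered `stub_darkTorsion`, verbatim. -/
def DarkTorsionOne : Prop :=
  ∀ c : KZ.FormalRep, KZ.eval c = 0 → ∃ l : List (KZ.IntegralRep 1), (∀ s ∈ l, s.value ≠ 0) ∧
    List.foldr (fun s x => KZ.of s * x) c l ∈ KZ.relations

/-- SF₁ (spectator fibration): the registered `stub_spectatorFibration`, verbatim. -/
def SpectatorFibrationOne : Prop :=
  ∀ (s : KZ.IntegralRep 1) (c : KZ.FormalRep), s.value ≠ 0 → KZ.of s * c ∈ KZ.relations →
    ∃ c' : KZ.FormalRep, c - c' ∈ KZ.relations ∧ KZ.of s * c' ∈ KZ.fibredRelations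

/-- The decomposition glue `Sub₁ → Sub₂ → Crux`, sorry-free from tree theorems. -/
theorem LogKernelConjecture_of_subs (h₁ : DarkTorsionOne) (h₂ : SpectatorFibrationOne) :
    LogKernelConjecture :=
  Summit.KontsevichZagierPeriods.LiouvilleUnfolding.SpectatorLocalisation.logKernelConjecture_iff_summit.2
    (Summit.KontsevichZagierPeriods.LiouvilleUnfolding.LogKernelConjectureCensus.summit_iff_darkTorsion₁_and_spectatorFibration₁.2
      ⟨h₁, h₂⟩)

/-- … and its converse: the split is EXACT, so the two pieces are jointly the summit. -/
theorem subs_of_LogKernelConjecture (h : LogKernelConjecture) :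
    DarkTorsionOne ∧ SpectatorFibrationOne :=
  Summit.KontsevichZagierPeriods.LiouvilleUnfolding.LogKernelConjectureCensus.summit_iff_darkTorsion₁_and_spectatorFibration₁.1
    (Summit.KontsevichZagierPeriods.LiouvilleUnfolding.SpectatorLocalisation.logKernelConjecture_iff_summit.1 h)

/-! ## §D-b The dimension split -/

/-- Formal combinations supported on representations of dimension `≤ D`. -/
def supportedLe (D : ℕ) : AddSubgroup KZ.FormalRep :=
  AddSubgroup.closure {c | ∃ (d : ℕ) (s : KZ.IntegralRep d), d ≤ D ∧ c = KZ.of s}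

/-- K≤1 (kernel form of LowDimension's layer `d ≤ 1`, items 10622/4990/0117: Baker + Huber–Wüstholz
transfer): every vanishing combination of representations of dimension `≤ 1` is a four-move relation. -/
def KernelDimLeOne : Prop :=
  ∀ c ∈ supportedLe 1, KZ.eval c = 0 → c ∈ KZ.relations

/-- The complement: every vanishing combination is congruent, modulo the four moves, to a vanishing
combination of dimension `≤ 1`. -/
def KernelReducesToDimOne : Prop :=
  ∀ c : KZ.FormalRep, KZ.eval c = 0 →
    ∃ c₁ ∈ supportedLe 1, KZ.eval c₁ = 0 ∧ c - c₁ ∈ KZ.relations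

/-- Glue of the dimension split. -/
theorem kzKernelConjecture_of_dim (h₁ : KernelDimLeOne) (h₂ : KernelReducesToDimOne) :
    KZKernelConjecture := by
  intro c hc
  obtain ⟨c₁, hc₁, hev, hrel⟩ := h₂ c hc
  have : c = (c - c₁) + c₁ := by abel
  rw [this]
  exact add_mem hrel (h₁ c₁ hc₁ hev)

theorem LogKernelConjecture_of_dim (h₁ : KernelDimLeOne) (h₂ : KernelReducesToDimOne) :
    LogKernelConjecture :=
  Summit.KontsevichZagierPeriods.LiouvilleUnfolding.SpectatorLocalisation.logKernelConjecture_iff_kzKernelConjecture.2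
    (kzKernelConjecture_of_dim h₁ h₂)

/-- The second piece is implied by the summit with `c₁ := 0`: modulo the theorem-grade first piece it
IS the crux. -/
theorem kernelReducesToDimOne_of_kzKernelConjecture (h : KZKernelConjecture) :
    KernelReducesToDimOne := fun c hc =>
  ⟨0, zero_mem _, by simp, by simpa using h c hc⟩

/-! ## §S Strengthenings -/

/-- Relations generated by move instances all of whose representations have dimension `≤ D`. -/
def relationsDim (D : ℕ) : AddSubgroup KZ.FormalRep :=
  AddSubgroup.closure ((KZ.domainAddRel ∪ KZ.integrandAddRel ∪ KZ.changeOfVariablesRel ∪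
    KZ.newtonLeibnizRel) ∩ (supportedLe D : Set KZ.FormalRep))

theorem relationsDim_le (D : ℕ) : relationsDim D ≤ KZ.relations :=
  AddSubgroup.closure_mono Set.inter_subset_left

/-- S⁺_height: Conjecture 1 with excursion height bounded by `h` above `max n m`. -/
def BoundedHeightKZ (h : ℕ) : Prop :=
  ∀ ⦃n m : ℕ⦄ (r : KZ.IntegralRep n) (r' : KZ.IntegralRep m), r.IsRational → r'.IsRational →
    r.value = r'.value → KZ.of r - KZ.of r' ∈ relationsDim (max n m + h)

/-- S⁺_height ⇒ summit (routine, as a strengthening must be). -/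
theorem summit_of_boundedHeightKZ (h : ℕ) (H : BoundedHeightKZ h) : KontsevichZagierPeriods :=
  fun _ _ r r' hr hr' hv => relationsDim_le _ (H r r' hr hr' hv)

/-- The FUNCTIONAL dilation statement along the rational pencil `ϖ ∈ (0,1] ∩ ℚ` at the cube vertex
(the tractable part that S⁺_unif reduces to off the isolated coincidences; cf. LiftingCriteria
`DilationTransfer`, AyoubRelKZRevisited Thm 1.7): a combination of cube representations
`[[0,1]ⁿ, gᵢ(ϖ z)]` vanishing for EVERY rational `ϖ` is a four-move relation at every rational `ϖ`. -/
def FunctionalDilationKZ : Prop :=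
  ∀ (n k : ℕ) (g : Fin k → (Fin n → ℝ) → ℝ) (m : Fin k → ℤ) (r : Fin k → ℚ → KZ.IntegralRep n),
    (∀ i (q : ℚ), 0 < q → q ≤ 1 → (r i q).domain = Set.Icc 0 1 ∧
      ∀ z ∈ Set.Icc (0 : Fin n → ℝ) 1, (r i q).integrand z = g i (fun j => (q : ℝ) * z j)) →
    (∀ q : ℚ, 0 < q → q ≤ 1 → ∑ i, (m i : ℝ) * (r i q).value = 0) →
    ∀ q : ℚ, 0 < q → q ≤ 1 → ∑ i, m i • KZ.of (r i q) ∈ KZ.relations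

/-- The functional statement is BELOW the summit (pointwise application of the kernel conjecture). -/
theorem functionalDilationKZ_of_summit (h : KontsevichZagierPeriods) : FunctionalDilationKZ := by
  have hK : KZKernelConjecture :=
    kzKernelConjecture_iff_isRational.mpr (KontsevichZagierPeriods_iff.mp h)
  intro n k g m r _ hval q hq hq1
  apply hK
  simp only [map_sum, map_zsmul, KZ.eval_of, zsmul_eq_mul]
  exact hval q hq hq1

end Summit.KontsevichZagierPeriods.KontsevichZagierPeriods.Cruxes.LogKernelConjecture.Strategist
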